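import Literature.NumberTheory.Rogawski1990.UnitFundamentalLemmaInertResiduallyRegularExplicit  -- ★ p840117 JUNCTION-rr (brings ★ (D1), ★ (D2))
import Literature.NumberTheory.Rogawski1990.FinExplicitTransferFactorStableInvariance       -- ★ p839998 `Δ‴_v` is a stable class function of `γ_H`
import HarnessLib

/-!
# [Rogawski1990 §4.9 Prop. 4.9.1 (b)] The unit fundamental lemma at an INERT place, III: the VANISHING clause for classes
# with non-integral characteristic polynomial, and the transport of the clause along stable conjugacy in `H_v`
(Rogawski (1990), §4.3 (4.3.1)–(4.3.2) p. 43, §4.9 Prop. 4.9.1 (b) p. 55, §4.1 (4.1.1) pp. 39–40; Kottwitz (1986), §7)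

Topic `NumberTheory/Rogawski1990`; namespace `Literature.NumberTheory.Rogawski1990`.  THEOREMS ONLY (no definition, no
instance, no named fact, no `sorry`).  Cell `pub/hodgecm-mathlib`, programme P3a, road «D-N7-inert», deal (N1) «JUNCTION-∅ +
stable-conjugacy transport» (LEAD F0P3a-plan (g9) T8-23 (C)(1); seat A-p06 (g26); map v2 `CENSUS-D-N7-inert-MAP.v2` §0
populations (P4) and the transport rider of §3).  HONEST LABEL: HC_CM is proved only modulo the 2 remaining named inputs
(hLiu418, h413) until rung 0 closes; this file proves NO letter — it discharges the clause of ★ `IsLocalUnitTransfer`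
(letter N7-ns ★ `UnitFundamentalLemmaExplicitNonsplit`, books #103-ns) on population (P4) and makes every per-`γ_H` clause a
statement about the STABLE CLASS of `γ_H`.

THE PRINT.  [Rogawski1990] §4.3 (4.3.1) p. 43 «`Φ^st(γ, f^H) = Δ_{G∕H}(γ) Φ^κ(γ, f)`»; §4.9 Prop. 4.9.1 (b) p. 55 at the units
`f = 1_K`, `f^H = 1_{K_H}`.  Two elementary remarks the print leaves implicit: (i) if the characteristic polynomial of `ι(γ_H)`
is not `𝒪_w`-integral then NO conjugate of `γ_H` lies in `K_H` and NO element matching `γ_H` lies in `K′` (an element of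
`GL₃(𝒪_w)` has an integral characteristic polynomial, and matching ∕ stable conjugacy preserve characteristic polynomials), so
both sides of (4.3.1) at the units VANISH; (ii) both sides of the clause depend on `γ_H` only through its stable class
(«`Δ_{G∕H}(γ_H, γ)` depends only on the stable conjugacy class of `γ_H` in `H`», §4.3 p. 43; `Φ^st` by definition (4.1.1)).

* §1 GENERIC (groups `A` «`H`», `B` «`G`», any `R`, `st`, ★ `TransferFactorData`, any families, any sets `K_H`, `K`):
  `finsum_delta_mul_classOrbitalIntegral_indicator_eq_zero_of_forall_not_rel` (the `G`-side is `0` when no `k ∈ K` matches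
  `a`), `stableOrbitalIntegralRel_indicator_eq_zero_of_forall_not_st` (the `H`-side is `0` when no `k ∈ K_H` is stably conjugate
  to `a`), `stableOrbitalIntegralRel_indicator_eq_finsum_delta_of_forall_not` (hence the clause).
* §2 `GL_n` over a valued field: `coeff_charpoly_mem_integer_of_mem_glInt` (elements of `GL_n(𝒪)` have integral
  characteristic polynomials).
* §3 the CM non-split place, population (P4): `not_isLocalNormPair_of_mem_cmLocalIntegralLevel_of_not_integral`,
  `not_isLocalStablyConjH_of_mem_prod_of_not_integral`, and the HEAD
  **`stableOrbitalIntegralRel_indicator_eq_finsum_delta_of_not_integral_of_nonsplit`** — for ANY local transfer factor and ANY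
  orbital measure families, with the only frame binder «`v` non-split».
* §4 TRANSPORT along stable conjugacy in `H_v`, for the explicit collection `Δ‴ = finExplicitCollection L H′ μ hl hr`:
  **`stableOrbitalIntegralRel_indicator_eq_finsum_finExplicitDelta_iff_of_isLocalStablyConjH`** (★ `stableOrbitalIntegralRel_congr`
  + ★ `finExplicitCollection_Δ_eq_of_isLocalStablyConjH`) and the corollary
  **`stableOrbitalIntegralRel_indicator_eq_finsum_finExplicitDelta_of_isLocalStablyConjH_of_separable_redMat_of_nonsplit`**:
  ★ JUNCTION-rr's clause (population (P1)) at every `γ_H′` STABLY CONJUGATE to a `γ_H ∈ K_H` with residually regular `ι_v(γ_H)`.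

NOT here: population (P2) (the Levi classes: JUNCTION-Levi, F0P3b-p01), population (P3) (the lattice count, held), the
converse «integral characteristic polynomial ⇒ the stable class meets `K_H`».

## References
* [Rogawski1990] J. D. Rogawski, *Automorphic Representations of Unitary Groups in Three Variables*, Ann. of Math. Stud.
  123 (1990): §4.1 (4.1.1) pp. 39–40; §4.3 (4.3.1)–(4.3.2) p. 43; §4.9 Prop. 4.9.1 (b) p. 55.
* [Kottwitz1986] R. E. Kottwitz, *Base change for unit elements of Hecke algebras*, Compositio Math. 60 (1986): §7.
-/

set_option autoImplicit false

noncomputable section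

open MeasureTheory Measure Set Function NumberField IsDedekindDomain Matrix Polynomial
open Literature.NumberTheory.Automorphic Literature.NumberTheory.Automorphic.UnitaryGroup
open Literature.NumberTheory.Automorphic.IntegralReduction Literature.NumberTheory.GaloisRepresentations
open scoped Matrix MatrixGroups ValuativeRel

namespace Literature.NumberTheory.Rogawski1990

/-! ## §1 Generic: both sides of (4.3.1) at the units vanish when no class meets the levels -/

section Generic

variable {A B : Type*} [Group A] [Group B]

/-- The class of a conjugate of `out c` is `c`. [cite: Rogawski1990, §4.1 (4.1.1) p. 39] -/
private theorem mk_conj_out_eq' (c : ConjClasses B) (y : B) : ConjClasses.mk (y * Quotient.out c * y⁻¹) = c := by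
  rw [← ConjClasses.mk_eq_mk_iff_isConj.2 (isConj_iff.2 ⟨y, rfl⟩)]
  exact Quotient.out_eq c

/-- **The `G`-side of (4.3.1) at the unit VANISHES when no element of `K` matches `a`**: for a transfer factor `T`
supported on `R` (★ `TransferFactorData`), any family `mG` and `K ⊆ B` with `∀ k ∈ K, ¬ R a k`:
`∑ᶠ c, Δ(a, out c) · Φ(c, 1_K) = 0` — a class missing `K` has `Φ(c, 1_K) = 0` (★ (D1)), a class meeting `K` at
`k = y (out c) y⁻¹` has `Δ(a, out c) = Δ(a, k) = 0`. [cite: Rogawski1990, §4.3 (4.3.1)–(4.3.2) p. 43; §4.9 p. 54] -/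
theorem finsum_delta_mul_classOrbitalIntegral_indicator_eq_zero_of_forall_not_rel
    [∀ b : B, MeasurableSpace (B ⧸ Subgroup.centralizer ({b} : Set B))] {R : A → B → Prop}
    (T : TransferFactorData A B R) (mG : OrbitalMeasureFamily B) (K : Set B) (a : A) (hK : ∀ k ∈ K, ¬ R a k) :
    ∑ᶠ c : ConjClasses B, T.Δ a (Quotient.out c) * classOrbitalIntegral mG (K.indicator fun _ => (1 : ℂ)) c = 0 := by
  have h0 : (fun c : ConjClasses B =>
      T.Δ a (Quotient.out c) * classOrbitalIntegral mG (K.indicator fun _ => (1 : ℂ)) c) = fun _ => 0 := by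
    funext c
    by_cases hc : ∃ y : B, y * Quotient.out c * y⁻¹ ∈ K
    · obtain ⟨y, hy⟩ := hc
      have hΔ : T.Δ a (Quotient.out c) = 0 := by
        rw [← T.conj_right a (Quotient.out c) y]
        exact T.eq_zero_of_not_rel _ _ (hK _ hy)
      rw [hΔ, zero_mul]
    · push Not at hc
      rw [classOrbitalIntegral_indicator_eq_zero_of_forall_conj_notMem mG K c hc, mul_zero]
  rw [h0, finsum_zero]

/-- **The `H`-side of (4.3.1) at the unit VANISHES when no element of `K_H` is stably conjugate to `a`**: for a «stable
conjugacy» `st` stable under conjugating its second argument (`hconj`), any family `mH`, and `K_H ⊆ A` with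
`∀ k ∈ K_H, ¬ st a k`: `Φ^st(a, 1_{K_H}) = 0` (every class in the `st`-class of `a` misses `K_H`).
[cite: Rogawski1990, §4.1 (4.1.1) p. 39; §4.3 p. 43] -/
theorem stableOrbitalIntegralRel_indicator_eq_zero_of_forall_not_st
    [∀ a : A, MeasurableSpace (A ⧸ Subgroup.centralizer ({a} : Set A))] (st : A → A → Prop)
    (mH : OrbitalMeasureFamily A) (KH : Set A) (a : A) (hconj : ∀ (b y : A), st a b → st a (y * b * y⁻¹))
    (hK : ∀ k ∈ KH, ¬ st a k) :
    stableOrbitalIntegralRel st mH (KH.indicator fun _ => (1 : ℂ)) a = 0 := by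
  rw [stableOrbitalIntegralRel_def, finsum_mem_def]
  have h0 : (fun c : ConjClasses A => {c : ConjClasses A | st a (Quotient.out c)}.indicator
      (fun c => classOrbitalIntegral mH (KH.indicator fun _ => (1 : ℂ)) c) c) = fun _ => 0 := by
    funext c
    by_cases hc : c ∈ {c : ConjClasses A | st a (Quotient.out c)}
    · rw [Set.indicator_of_mem hc]
      refine classOrbitalIntegral_indicator_eq_zero_of_forall_conj_notMem mH KH c fun y hy => ?_
      exact hK _ hy (hconj _ y hc)
    · exact Set.indicator_of_notMem hc _
  rw [h0, finsum_zero]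

/-- **The clause of (4.3.1) at the units holds (`0 = 0`) when neither level is met**: `∀ k ∈ K_H, ¬ st a k` and
`∀ k ∈ K, ¬ R a k` ⇒ `Φ^st(a, 1_{K_H}) = ∑ᶠ c, Δ(a, out c) · Φ(c, 1_K)`. [cite: Rogawski1990, §4.3 (4.3.1) p. 43; §4.9 Prop. 4.9.1 (b) p. 55] -/
theorem stableOrbitalIntegralRel_indicator_eq_finsum_delta_of_forall_not
    [∀ a : A, MeasurableSpace (A ⧸ Subgroup.centralizer ({a} : Set A))]
    [∀ b : B, MeasurableSpace (B ⧸ Subgroup.centralizer ({b} : Set B))] {R : A → B → Prop} (st : A → A → Prop)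
    (T : TransferFactorData A B R) (mH : OrbitalMeasureFamily A) (mG : OrbitalMeasureFamily B) (KH : Set A) (K : Set B)
    (a : A) (hconj : ∀ (b y : A), st a b → st a (y * b * y⁻¹)) (hKH : ∀ k ∈ KH, ¬ st a k) (hK : ∀ k ∈ K, ¬ R a k) :
    stableOrbitalIntegralRel st mH (KH.indicator fun _ => (1 : ℂ)) a =
      ∑ᶠ c : ConjClasses B, T.Δ a (Quotient.out c) * classOrbitalIntegral mG (K.indicator fun _ => (1 : ℂ)) c := by
  rw [stableOrbitalIntegralRel_indicator_eq_zero_of_forall_not_st st mH KH a hconj hKH,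
    finsum_delta_mul_classOrbitalIntegral_indicator_eq_zero_of_forall_not_rel T mG K a hK]

end Generic

/-! ## §2 Elements of `GL_n(𝒪)` have integral characteristic polynomials -/

section GLn

variable {F : Type*} [Field F] [ValuativeRel F] {n : ℕ}

/-- **`g ∈ GL_n(𝒪) ⇒ charpoly g ∈ 𝒪[X]`**: every coefficient of the characteristic polynomial of an element of ★ `glInt n F`
(the image of `GL_n(𝒪) → GL_n(F)`) is integral (`charpoly` commutes with `𝒪 ↪ F`). [cite: Kottwitz1986, §7] -/
theorem coeff_charpoly_mem_integer_of_mem_glInt {g : GL (Fin n) F} (hg : g ∈ glInt n F) (i : ℕ) :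
    ((g : Matrix (Fin n) (Fin n) F).charpoly.coeff i) ∈ 𝒪[F] := by
  obtain ⟨γO, rfl⟩ := hg
  have h : ((Matrix.GeneralLinearGroup.map (𝒪[F]).subtype γO : GL (Fin n) F) : Matrix (Fin n) (Fin n) F).charpoly =
      (γO : Matrix (Fin n) (Fin n) 𝒪[F]).charpoly.map (𝒪[F]).subtype := by
    rw [← Matrix.charpoly_map]; rfl
  rw [h, Polynomial.coeff_map]
  exact SetLike.coe_mem _

end GLn

/-! ## §3 Population (P4) at a non-split place: non-integral characteristic polynomial ⇒ both sides vanish -/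

section NonIntegral

variable (L : Type) [Field L] [NumberField L] [IsCMField L] (H' : Matrix (Fin 3) (Fin 3) L)
  {v : HeightOneSpectrum (𝓞 ↥(maximalRealSubfield L))}

/-- **No element of `K′ = U(H′)(𝒪_v)` matches `γ_H` when the characteristic polynomial of `ι_v(γ_H)_w` is not integral**
(non-split `w ∣ v`): a matching `k ∈ K′` (★ `IsLocalNormPair` = conjugacy in `GL₃(∏_{w′} L_{w′})`) would have the same
characteristic polynomial, and `k_w ∈ GL₃(𝒪_w)` (★ `mem_localIntegralLevel_iff_of_smul_eq`) has an integral one.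
[cite: Rogawski1990, §4.9 p. 54; §14.1 p. 232] [cite: Kottwitz1986, §7] -/
theorem not_isLocalNormPair_of_mem_cmLocalIntegralLevel_of_not_integral (w : PlacesOver L v)
    (hw : IsCMField.complexConj L • w.1 = w.1)
    {γH : (cmDatum L 2 (Matrix.of fun i j : Fin 2 => if i.val + j.val + 1 = 2 then (1 : L) else 0)).Local v ×
      (cmDatum L 1 (Matrix.of fun i j : Fin 1 => if i.val + j.val + 1 = 1 then (1 : L) else 0)).Local v}
    (hni : ¬ ∀ i : ℕ, ((((endoEmbLocal L v γH).val : GL (Fin 3) (LocalRing L v)).val.map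
      (Pi.evalRingHom (fun w' : PlacesOver L v => w'.1.adicCompletion L) w)).charpoly.coeff i) ∈ 𝒪[w.1.adicCompletion L])
    {k : (cmDatum L 3 H').Local v} (hk : k ∈ cmLocalIntegralLevel L 3 H' v) : ¬ IsLocalNormPair L H' v γH k := by
  intro hmatch
  have hc := IsCMField.complexConj_ne_one L
  apply hni
  intro i
  -- matching ⇒ equal characteristic polynomials in `GL₃(∏ L_{w′})`, hence of the `w`-components
  have hchar : (((endoEmbLocal L v γH).val : GL (Fin 3) (LocalRing L v)).val.map
      (Pi.evalRingHom (fun w' : PlacesOver L v => w'.1.adicCompletion L) w)).charpoly =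
      ((k.val : GL (Fin 3) (LocalRing L v)).val.map
        (Pi.evalRingHom (fun w' : PlacesOver L v => w'.1.adicCompletion L) w)).charpoly := by
    rw [Matrix.charpoly_map, Matrix.charpoly_map]
    exact congrArg (Polynomial.map (Pi.evalRingHom (fun w' : PlacesOver L v => w'.1.adicCompletion L) w))
      (Corresponds.charpoly_eq hmatch)
  rw [hchar]
  exact coeff_charpoly_mem_integer_of_mem_glInt
    ((mem_localIntegralLevel_iff_of_smul_eq (IsCMField.complexConj L) 3 H' hc w hw k).1 hk) i

/-- **No element of `K_H = U(Φ₂)(𝒪_v) ×ˢ U(Φ₁)(𝒪_v)` is stably conjugate to `γ_H` when the characteristic polynomial of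
`ι_v(γ_H)_w` is not integral** (non-split `w ∣ v`): stable conjugacy in `H_v` makes `ι_v(γ_H)`, `ι_v(k)` stably conjugate (★
`isStablyConj_endoEmbLocal_of_isLocalStablyConjH`), hence with equal characteristic polynomials, and `ι_v(k) ∈ K` (★
`endoEmbLocal_mem_cmLocalIntegralLevel_of_nonsplit`) has an integral one. [cite: Rogawski1990, §4.2 p. 42; §3.1 p. 19] [cite: Kottwitz1986, §7] -/
theorem not_isLocalStablyConjH_of_mem_prod_of_not_integral (w : PlacesOver L v) (hw : IsCMField.complexConj L • w.1 = w.1)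
    {γH : (cmDatum L 2 (Matrix.of fun i j : Fin 2 => if i.val + j.val + 1 = 2 then (1 : L) else 0)).Local v ×
      (cmDatum L 1 (Matrix.of fun i j : Fin 1 => if i.val + j.val + 1 = 1 then (1 : L) else 0)).Local v}
    (hni : ¬ ∀ i : ℕ, ((((endoEmbLocal L v γH).val : GL (Fin 3) (LocalRing L v)).val.map
      (Pi.evalRingHom (fun w' : PlacesOver L v => w'.1.adicCompletion L) w)).charpoly.coeff i) ∈ 𝒪[w.1.adicCompletion L])
    {k : (cmDatum L 2 (Matrix.of fun i j : Fin 2 => if i.val + j.val + 1 = 2 then (1 : L) else 0)).Local v ×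
      (cmDatum L 1 (Matrix.of fun i j : Fin 1 => if i.val + j.val + 1 = 1 then (1 : L) else 0)).Local v}
    (hk : k ∈ (cmLocalIntegralLevel L 2 (Matrix.of fun i j : Fin 2 => if i.val + j.val + 1 = 2 then (1 : L) else 0) v).prod
      (cmLocalIntegralLevel L 1 (Matrix.of fun i j : Fin 1 => if i.val + j.val + 1 = 1 then (1 : L) else 0) v)) :
    ¬ IsLocalStablyConjH L v γH k := by
  intro hst
  have hc := IsCMField.complexConj_ne_one L
  apply hni
  intro i
  have hchar : (((endoEmbLocal L v γH).val : GL (Fin 3) (LocalRing L v)).val.map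
      (Pi.evalRingHom (fun w' : PlacesOver L v => w'.1.adicCompletion L) w)).charpoly =
      (((endoEmbLocal L v k).val : GL (Fin 3) (LocalRing L v)).val.map
        (Pi.evalRingHom (fun w' : PlacesOver L v => w'.1.adicCompletion L) w)).charpoly := by
    rw [Matrix.charpoly_map, Matrix.charpoly_map]
    exact congrArg (Polynomial.map (Pi.evalRingHom (fun w' : PlacesOver L v => w'.1.adicCompletion L) w))
      (isStablyConj_endoEmbLocal_of_isLocalStablyConjH L v hst).charpoly_eq
  rw [hchar]
  exact coeff_charpoly_mem_integer_of_mem_glInt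
    ((mem_localIntegralLevel_iff_of_smul_eq (IsCMField.complexConj L) 3 _ hc w hw (endoEmbLocal L v k)).1
      (endoEmbLocal_mem_cmLocalIntegralLevel_of_nonsplit L w hw hk)) i

/-- **POPULATION (P4): THE CLAUSE OF (4.3.1) ∕ Prop. 4.9.1 (b) AT THE UNITS HOLDS — BOTH SIDES VANISH — at every `γ_H ∈ H_v`
whose image `ι_v(γ_H)` has a NON-INTEGRAL characteristic polynomial at the non-split place `w ∣ v`**, for ANY local
transfer factor `T` (★ `LocalTransferFactor`: supported on the matching pairs) and ANY orbital measure families `mH`, `mG`: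
`Φ^st(γ_H, 1_{K_H}) = ∑ᶠ c, Δ(γ_H, out c) · Φ(c, 1_{K′})` — the body of ★ `IsLocalDeltaTransfer` ∕ `IsLocalUnitTransfer L H′ v T mH mG`
at this `γ_H` (§1 with §3's two emptiness statements; `G`-regularity is not needed). [cite: Rogawski1990, §4.9 Prop. 4.9.1 (b) p. 55; §4.3 (4.3.1) p. 43]
[cite: Kottwitz1986, §7] -/
theorem stableOrbitalIntegralRel_indicator_eq_finsum_delta_of_not_integral_of_nonsplit (w : PlacesOver L v)
    (hw : IsCMField.complexConj L • w.1 = w.1)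
    [∀ γ : ((cmDatum L 3 H').Local v), MeasurableSpace (((cmDatum L 3 H').Local v) ⧸ Subgroup.centralizer ({γ} : Set ((cmDatum L 3 H').Local v)))]
    [∀ a : ((cmDatum L 2 (Matrix.of fun i j : Fin 2 => if i.val + j.val + 1 = 2 then (1 : L) else 0)).Local v ×
      (cmDatum L 1 (Matrix.of fun i j : Fin 1 => if i.val + j.val + 1 = 1 then (1 : L) else 0)).Local v),
      MeasurableSpace (((cmDatum L 2 (Matrix.of fun i j : Fin 2 => if i.val + j.val + 1 = 2 then (1 : L) else 0)).Local v ×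
      (cmDatum L 1 (Matrix.of fun i j : Fin 1 => if i.val + j.val + 1 = 1 then (1 : L) else 0)).Local v) ⧸ Subgroup.centralizer ({a} : Set ((cmDatum L 2 (Matrix.of fun i j : Fin 2 => if i.val + j.val + 1 = 2 then (1 : L) else 0)).Local v ×
      (cmDatum L 1 (Matrix.of fun i j : Fin 1 => if i.val + j.val + 1 = 1 then (1 : L) else 0)).Local v)))]
    (T : LocalTransferFactor L H' v)
    (mH : OrbitalMeasureFamily ((cmDatum L 2 (Matrix.of fun i j : Fin 2 => if i.val + j.val + 1 = 2 then (1 : L) else 0)).Local v ×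
      (cmDatum L 1 (Matrix.of fun i j : Fin 1 => if i.val + j.val + 1 = 1 then (1 : L) else 0)).Local v))
    (mG : OrbitalMeasureFamily ((cmDatum L 3 H').Local v))
    {γH : (cmDatum L 2 (Matrix.of fun i j : Fin 2 => if i.val + j.val + 1 = 2 then (1 : L) else 0)).Local v ×
      (cmDatum L 1 (Matrix.of fun i j : Fin 1 => if i.val + j.val + 1 = 1 then (1 : L) else 0)).Local v}
    (hni : ¬ ∀ i : ℕ, ((((endoEmbLocal L v γH).val : GL (Fin 3) (LocalRing L v)).val.map
      (Pi.evalRingHom (fun w' : PlacesOver L v => w'.1.adicCompletion L) w)).charpoly.coeff i) ∈ 𝒪[w.1.adicCompletion L]) :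
    stableOrbitalIntegralRel (IsLocalStablyConjH L v) mH
        (((((cmLocalIntegralLevel L 2 (Matrix.of fun i j : Fin 2 => if i.val + j.val + 1 = 2 then (1 : L) else 0) v).prod
      (cmLocalIntegralLevel L 1 (Matrix.of fun i j : Fin 1 => if i.val + j.val + 1 = 1 then (1 : L) else 0) v)) : Subgroup ((cmDatum L 2 (Matrix.of fun i j : Fin 2 => if i.val + j.val + 1 = 2 then (1 : L) else 0)).Local v ×
      (cmDatum L 1 (Matrix.of fun i j : Fin 1 => if i.val + j.val + 1 = 1 then (1 : L) else 0)).Local v)) : Set ((cmDatum L 2 (Matrix.of fun i j : Fin 2 => if i.val + j.val + 1 = 2 then (1 : L) else 0)).Local v ×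
      (cmDatum L 1 (Matrix.of fun i j : Fin 1 => if i.val + j.val + 1 = 1 then (1 : L) else 0)).Local v)).indicator fun _ => (1 : ℂ)) γH =
      ∑ᶠ c : ConjClasses ((cmDatum L 3 H').Local v), T.Δ γH (Quotient.out c) *
        classOrbitalIntegral mG ((cmLocalIntegralLevel L 3 H' v : Set ((cmDatum L 3 H').Local v)).indicator fun _ => (1 : ℂ)) c :=
  stableOrbitalIntegralRel_indicator_eq_finsum_delta_of_forall_not (IsLocalStablyConjH L v) T mH mG
    ((((cmLocalIntegralLevel L 2 (Matrix.of fun i j : Fin 2 => if i.val + j.val + 1 = 2 then (1 : L) else 0) v).prod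
      (cmLocalIntegralLevel L 1 (Matrix.of fun i j : Fin 1 => if i.val + j.val + 1 = 1 then (1 : L) else 0) v)) :
      Subgroup ((cmDatum L 2 (Matrix.of fun i j : Fin 2 => if i.val + j.val + 1 = 2 then (1 : L) else 0)).Local v ×
        (cmDatum L 1 (Matrix.of fun i j : Fin 1 => if i.val + j.val + 1 = 1 then (1 : L) else 0)).Local v)) :
      Set ((cmDatum L 2 (Matrix.of fun i j : Fin 2 => if i.val + j.val + 1 = 2 then (1 : L) else 0)).Local v ×
        (cmDatum L 1 (Matrix.of fun i j : Fin 1 => if i.val + j.val + 1 = 1 then (1 : L) else 0)).Local v))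
    (cmLocalIntegralLevel L 3 H' v : Set ((cmDatum L 3 H').Local v)) γH
    (isLocalStablyConjH_of_isConj_and_conj L γH).2
    (fun _ hk => not_isLocalStablyConjH_of_mem_prod_of_not_integral L w hw hni hk)
    (fun _ hk => not_isLocalNormPair_of_mem_cmLocalIntegralLevel_of_not_integral L H' w hw hni hk)

end NonIntegral

/-! ## §4 Transport of the clause along stable conjugacy in `H_v` (explicit factor `Δ‴_v`) -/

section Transport

variable (L : Type) [Field L] [NumberField L] [IsCMField L] (H' : Matrix (Fin 3) (Fin 3) L)
  {v : HeightOneSpectrum (𝓞 ↥(maximalRealSubfield L))}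

open scoped Classical in
/-- **Both sides of the clause are stable class functions of `γ_H`**: for `γ_H ∼_st γ_H′` in `H_v` (★ `IsLocalStablyConjH`)
and the explicit collection `Δ‴ = finExplicitCollection L H′ μ hl hr`, the clause of (4.3.1) at `γ_H` holds iff it holds at
`γ_H′` — `Φ^st(·, f^H)` sees only the stable class (★ `stableOrbitalIntegralRel_congr`, (4.1.1)) and so does `Δ‴_v(·, γ)`
(★ `finExplicitCollection_Δ_eq_of_isLocalStablyConjH`, «depends only on the stable conjugacy class of `γ_H`»), for ANY
functions `fH`, `f` and families. [cite: Rogawski1990, §4.1 (4.1.1) pp. 39–40; §4.3 p. 43] -/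
theorem stableOrbitalIntegralRel_eq_finsum_finExplicitDelta_iff_of_isLocalStablyConjH
    [∀ γ : ((cmDatum L 3 H').Local v), MeasurableSpace (((cmDatum L 3 H').Local v) ⧸ Subgroup.centralizer ({γ} : Set ((cmDatum L 3 H').Local v)))]
    [∀ a : ((cmDatum L 2 (Matrix.of fun i j : Fin 2 => if i.val + j.val + 1 = 2 then (1 : L) else 0)).Local v ×
      (cmDatum L 1 (Matrix.of fun i j : Fin 1 => if i.val + j.val + 1 = 1 then (1 : L) else 0)).Local v),
      MeasurableSpace (((cmDatum L 2 (Matrix.of fun i j : Fin 2 => if i.val + j.val + 1 = 2 then (1 : L) else 0)).Local v ×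
      (cmDatum L 1 (Matrix.of fun i j : Fin 1 => if i.val + j.val + 1 = 1 then (1 : L) else 0)).Local v) ⧸ Subgroup.centralizer ({a} : Set ((cmDatum L 2 (Matrix.of fun i j : Fin 2 => if i.val + j.val + 1 = 2 then (1 : L) else 0)).Local v ×
      (cmDatum L 1 (Matrix.of fun i j : Fin 1 => if i.val + j.val + 1 = 1 then (1 : L) else 0)).Local v)))]
    (μ : HeckeCharacter L)
    (hl : ∀ (v : HeightOneSpectrum (𝓞 ↥(maximalRealSubfield L)))
      (a : (cmDatum L 2 (Matrix.of fun i j : Fin 2 => if i.val + j.val + 1 = 2 then (1 : L) else 0)).Local v ×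
      (cmDatum L 1 (Matrix.of fun i j : Fin 1 => if i.val + j.val + 1 = 1 then (1 : L) else 0)).Local v)
      (b : (cmDatum L 3 H').Local v)
      (x : (cmDatum L 2 (Matrix.of fun i j : Fin 2 => if i.val + j.val + 1 = 2 then (1 : L) else 0)).Local v ×
      (cmDatum L 1 (Matrix.of fun i j : Fin 1 => if i.val + j.val + 1 = 1 then (1 : L) else 0)).Local v),
      finExplicitDelta L v H' (x * a * x⁻¹) μ b = finExplicitDelta L v H' a μ b)
    (hr : ∀ (v : HeightOneSpectrum (𝓞 ↥(maximalRealSubfield L)))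
      (a : (cmDatum L 2 (Matrix.of fun i j : Fin 2 => if i.val + j.val + 1 = 2 then (1 : L) else 0)).Local v ×
      (cmDatum L 1 (Matrix.of fun i j : Fin 1 => if i.val + j.val + 1 = 1 then (1 : L) else 0)).Local v)
      (b y : (cmDatum L 3 H').Local v),
      finExplicitDelta L v H' a μ (y * b * y⁻¹) = finExplicitDelta L v H' a μ b)
    (mH : OrbitalMeasureFamily ((cmDatum L 2 (Matrix.of fun i j : Fin 2 => if i.val + j.val + 1 = 2 then (1 : L) else 0)).Local v ×
      (cmDatum L 1 (Matrix.of fun i j : Fin 1 => if i.val + j.val + 1 = 1 then (1 : L) else 0)).Local v))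
    (mG : OrbitalMeasureFamily ((cmDatum L 3 H').Local v))
    (fH : (cmDatum L 2 (Matrix.of fun i j : Fin 2 => if i.val + j.val + 1 = 2 then (1 : L) else 0)).Local v ×
      (cmDatum L 1 (Matrix.of fun i j : Fin 1 => if i.val + j.val + 1 = 1 then (1 : L) else 0)).Local v → ℂ)
    (f : (cmDatum L 3 H').Local v → ℂ)
    {γH γH' : (cmDatum L 2 (Matrix.of fun i j : Fin 2 => if i.val + j.val + 1 = 2 then (1 : L) else 0)).Local v ×
      (cmDatum L 1 (Matrix.of fun i j : Fin 1 => if i.val + j.val + 1 = 1 then (1 : L) else 0)).Local v}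
    (h : IsLocalStablyConjH L v γH γH') :
    stableOrbitalIntegralRel (IsLocalStablyConjH L v) mH fH γH =
        ∑ᶠ c : ConjClasses ((cmDatum L 3 H').Local v), (finExplicitCollection L H' μ hl hr v).Δ γH (Quotient.out c) *
          classOrbitalIntegral mG f c ↔
      stableOrbitalIntegralRel (IsLocalStablyConjH L v) mH fH γH' =
        ∑ᶠ c : ConjClasses ((cmDatum L 3 H').Local v), (finExplicitCollection L H' μ hl hr v).Δ γH' (Quotient.out c) *
          classOrbitalIntegral mG f c := by
  have hiff : ∀ ε, IsLocalStablyConjH L v γH ε ↔ IsLocalStablyConjH L v γH' ε :=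
    fun ε => ⟨fun hε => IsStablyConjH.trans (IsStablyConjH.symm h) hε, fun hε => IsStablyConjH.trans h hε⟩
  have hst : stableOrbitalIntegralRel (IsLocalStablyConjH L v) mH fH γH =
      stableOrbitalIntegralRel (IsLocalStablyConjH L v) mH fH γH' :=
    stableOrbitalIntegralRel_congr (st := IsLocalStablyConjH L v) (γ := γH) (δ := γH') hiff mH fH
  have hfun : (fun c : ConjClasses ((cmDatum L 3 H').Local v) =>
        (finExplicitCollection L H' μ hl hr v).Δ γH' (Quotient.out c) * classOrbitalIntegral mG f c) =
      fun c => (finExplicitCollection L H' μ hl hr v).Δ γH (Quotient.out c) * classOrbitalIntegral mG f c :=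
    funext fun c => by rw [finExplicitCollection_Δ_eq_of_isLocalStablyConjH L v H' μ hl hr h (Quotient.out c)]
  rw [hst, hfun]
  exact Iff.rfl

open scoped Classical in
/-- **JUNCTION-rr TRANSPORTED: the clause with `Δ‴_v` at every `γ_H′` STABLY CONJUGATE to a residually regular integral `γ_H`.**
At a non-split unramified place of good reduction for `H′`, `μ` unramified at `w`, canonical families for the letter's predicates,
`νH(K_H) = νG(K′) = 1`: if `γ_H ∈ K_H` is `G`-regular with `ι_v(γ_H)` residually regular (binders of ★
`stableOrbitalIntegralRel_indicator_eq_finsum_finExplicitDelta_of_separable_redMat_of_nonsplit`) and `γ_H ∼_st γ_H′` in `H_v`, then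
`Φ^st(γ_H′, 1_{K_H}) = ∑ᶠ c, Δ‴_v(γ_H′, out c) · Φ(c, 1_{K′})` — population (P1) of the letter read on STABLE CLASSES.
[cite: Rogawski1990, §4.9 Prop. 4.9.1 (b) p. 55; §4.3 (4.3.1) p. 43; §4.1 (4.1.1) p. 40] [cite: Kottwitz1986, §7] -/
theorem stableOrbitalIntegralRel_indicator_eq_finsum_finExplicitDelta_of_isLocalStablyConjH_of_separable_redMat_of_nonsplit
    (hH' : (H'.map (IsCMField.complexConj L))ᵀ = H') (w : PlacesOver L v)
    (hw : IsCMField.complexConj L • w.1 = w.1) (hv : Algebra.IsUnramifiedIn (𝓞 L) v.asIdeal)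
    (hH'w : IsUnit (placeForm H' w.1)) (hH'i : hH'w.unit ∈ glInt 3 (w.1.adicCompletion L))
    (μ : HeckeCharacter L) (hμ : μ.IsUnramifiedAt w.1)
    [MeasurableSpace ((cmDatum L 3 H').Local v)] [BorelSpace ((cmDatum L 3 H').Local v)]
    [∀ γ : ((cmDatum L 3 H').Local v), MeasurableSpace (((cmDatum L 3 H').Local v) ⧸ Subgroup.centralizer ({γ} : Set ((cmDatum L 3 H').Local v)))]
    [∀ γ : ((cmDatum L 3 H').Local v), BorelSpace (((cmDatum L 3 H').Local v) ⧸ Subgroup.centralizer ({γ} : Set ((cmDatum L 3 H').Local v)))]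
    [MeasurableSpace ((cmDatum L 2 (Matrix.of fun i j : Fin 2 => if i.val + j.val + 1 = 2 then (1 : L) else 0)).Local v ×
      (cmDatum L 1 (Matrix.of fun i j : Fin 1 => if i.val + j.val + 1 = 1 then (1 : L) else 0)).Local v)]
    [BorelSpace ((cmDatum L 2 (Matrix.of fun i j : Fin 2 => if i.val + j.val + 1 = 2 then (1 : L) else 0)).Local v ×
      (cmDatum L 1 (Matrix.of fun i j : Fin 1 => if i.val + j.val + 1 = 1 then (1 : L) else 0)).Local v)]
    [∀ a : ((cmDatum L 2 (Matrix.of fun i j : Fin 2 => if i.val + j.val + 1 = 2 then (1 : L) else 0)).Local v ×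
      (cmDatum L 1 (Matrix.of fun i j : Fin 1 => if i.val + j.val + 1 = 1 then (1 : L) else 0)).Local v),
      MeasurableSpace (((cmDatum L 2 (Matrix.of fun i j : Fin 2 => if i.val + j.val + 1 = 2 then (1 : L) else 0)).Local v ×
      (cmDatum L 1 (Matrix.of fun i j : Fin 1 => if i.val + j.val + 1 = 1 then (1 : L) else 0)).Local v) ⧸ Subgroup.centralizer ({a} : Set ((cmDatum L 2 (Matrix.of fun i j : Fin 2 => if i.val + j.val + 1 = 2 then (1 : L) else 0)).Local v ×
      (cmDatum L 1 (Matrix.of fun i j : Fin 1 => if i.val + j.val + 1 = 1 then (1 : L) else 0)).Local v)))]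
    [∀ a : ((cmDatum L 2 (Matrix.of fun i j : Fin 2 => if i.val + j.val + 1 = 2 then (1 : L) else 0)).Local v ×
      (cmDatum L 1 (Matrix.of fun i j : Fin 1 => if i.val + j.val + 1 = 1 then (1 : L) else 0)).Local v),
      BorelSpace (((cmDatum L 2 (Matrix.of fun i j : Fin 2 => if i.val + j.val + 1 = 2 then (1 : L) else 0)).Local v ×
      (cmDatum L 1 (Matrix.of fun i j : Fin 1 => if i.val + j.val + 1 = 1 then (1 : L) else 0)).Local v) ⧸ Subgroup.centralizer ({a} : Set ((cmDatum L 2 (Matrix.of fun i j : Fin 2 => if i.val + j.val + 1 = 2 then (1 : L) else 0)).Local v ×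
      (cmDatum L 1 (Matrix.of fun i j : Fin 1 => if i.val + j.val + 1 = 1 then (1 : L) else 0)).Local v)))]
    (νH : Measure ((cmDatum L 2 (Matrix.of fun i j : Fin 2 => if i.val + j.val + 1 = 2 then (1 : L) else 0)).Local v ×
      (cmDatum L 1 (Matrix.of fun i j : Fin 1 => if i.val + j.val + 1 = 1 then (1 : L) else 0)).Local v)) [νH.IsHaarMeasure] [νH.IsMulRightInvariant]
    (νG : Measure ((cmDatum L 3 H').Local v)) [νG.IsHaarMeasure] [νG.IsMulRightInvariant]
    {mH : OrbitalMeasureFamily ((cmDatum L 2 (Matrix.of fun i j : Fin 2 => if i.val + j.val + 1 = 2 then (1 : L) else 0)).Local v ×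
      (cmDatum L 1 (Matrix.of fun i j : Fin 1 => if i.val + j.val + 1 = 1 then (1 : L) else 0)).Local v)} {mG : OrbitalMeasureFamily ((cmDatum L 3 H').Local v)}
    (hmH : mH.IsCanonical (IsLocalGRegular L v) νH)
    (hmG : mG.IsCanonical (fun γ => IsRegularElt (γ.val : GL (Fin 3) (UnitaryGroup.LocalRing L v))) νG)
    (hνH : νH ((((cmLocalIntegralLevel L 2 (Matrix.of fun i j : Fin 2 => if i.val + j.val + 1 = 2 then (1 : L) else 0) v).prod
      (cmLocalIntegralLevel L 1 (Matrix.of fun i j : Fin 1 => if i.val + j.val + 1 = 1 then (1 : L) else 0) v)) : Subgroup ((cmDatum L 2 (Matrix.of fun i j : Fin 2 => if i.val + j.val + 1 = 2 then (1 : L) else 0)).Local v ×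
      (cmDatum L 1 (Matrix.of fun i j : Fin 1 => if i.val + j.val + 1 = 1 then (1 : L) else 0)).Local v)) : Set ((cmDatum L 2 (Matrix.of fun i j : Fin 2 => if i.val + j.val + 1 = 2 then (1 : L) else 0)).Local v ×
      (cmDatum L 1 (Matrix.of fun i j : Fin 1 => if i.val + j.val + 1 = 1 then (1 : L) else 0)).Local v)) = 1)
    (hνG : νG (cmLocalIntegralLevel L 3 H' v : Set ((cmDatum L 3 H').Local v)) = 1)
    (hl : ∀ (v : HeightOneSpectrum (𝓞 ↥(maximalRealSubfield L)))
      (a : (cmDatum L 2 (Matrix.of fun i j : Fin 2 => if i.val + j.val + 1 = 2 then (1 : L) else 0)).Local v ×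
      (cmDatum L 1 (Matrix.of fun i j : Fin 1 => if i.val + j.val + 1 = 1 then (1 : L) else 0)).Local v)
      (b : (cmDatum L 3 H').Local v)
      (x : (cmDatum L 2 (Matrix.of fun i j : Fin 2 => if i.val + j.val + 1 = 2 then (1 : L) else 0)).Local v ×
      (cmDatum L 1 (Matrix.of fun i j : Fin 1 => if i.val + j.val + 1 = 1 then (1 : L) else 0)).Local v),
      finExplicitDelta L v H' (x * a * x⁻¹) μ b = finExplicitDelta L v H' a μ b)
    (hr : ∀ (v : HeightOneSpectrum (𝓞 ↥(maximalRealSubfield L)))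
      (a : (cmDatum L 2 (Matrix.of fun i j : Fin 2 => if i.val + j.val + 1 = 2 then (1 : L) else 0)).Local v ×
      (cmDatum L 1 (Matrix.of fun i j : Fin 1 => if i.val + j.val + 1 = 1 then (1 : L) else 0)).Local v)
      (b y : (cmDatum L 3 H').Local v),
      finExplicitDelta L v H' a μ (y * b * y⁻¹) = finExplicitDelta L v H' a μ b)
    {γH γH' : ((cmDatum L 2 (Matrix.of fun i j : Fin 2 => if i.val + j.val + 1 = 2 then (1 : L) else 0)).Local v ×
      (cmDatum L 1 (Matrix.of fun i j : Fin 1 => if i.val + j.val + 1 = 1 then (1 : L) else 0)).Local v)}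
    (hγH : γH ∈ ((cmLocalIntegralLevel L 2 (Matrix.of fun i j : Fin 2 => if i.val + j.val + 1 = 2 then (1 : L) else 0) v).prod
      (cmLocalIntegralLevel L 1 (Matrix.of fun i j : Fin 1 => if i.val + j.val + 1 = 1 then (1 : L) else 0) v))) (hreg : IsLocalGRegular L v γH)
    (hsepι : (redMat (((endoEmbLocal L v γH).val : GL (Fin 3) (LocalRing L v)).val.map
      (Pi.evalRingHom (fun w' : PlacesOver L v => w'.1.adicCompletion L) w))).charpoly.Separable)
    (hsep₂ : (redMat ((γH.1.val : GL (Fin 2) (LocalRing L v)).val.map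
      (Pi.evalRingHom (fun w' : PlacesOver L v => w'.1.adicCompletion L) w))).charpoly.Separable)
    (hc : Valued.v (((finCharpolyTwo L v γH).eval (finGammaTwo L v γH)) w) = 1)
    (h : IsLocalStablyConjH L v γH γH') :
    stableOrbitalIntegralRel (IsLocalStablyConjH L v) mH
        (((((cmLocalIntegralLevel L 2 (Matrix.of fun i j : Fin 2 => if i.val + j.val + 1 = 2 then (1 : L) else 0) v).prod
      (cmLocalIntegralLevel L 1 (Matrix.of fun i j : Fin 1 => if i.val + j.val + 1 = 1 then (1 : L) else 0) v)) : Subgroup ((cmDatum L 2 (Matrix.of fun i j : Fin 2 => if i.val + j.val + 1 = 2 then (1 : L) else 0)).Local v ×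
      (cmDatum L 1 (Matrix.of fun i j : Fin 1 => if i.val + j.val + 1 = 1 then (1 : L) else 0)).Local v)) : Set ((cmDatum L 2 (Matrix.of fun i j : Fin 2 => if i.val + j.val + 1 = 2 then (1 : L) else 0)).Local v ×
      (cmDatum L 1 (Matrix.of fun i j : Fin 1 => if i.val + j.val + 1 = 1 then (1 : L) else 0)).Local v)).indicator fun _ => (1 : ℂ)) γH' =
      ∑ᶠ c : ConjClasses ((cmDatum L 3 H').Local v), (finExplicitCollection L H' μ hl hr v).Δ γH' (Quotient.out c) *
        classOrbitalIntegral mG ((cmLocalIntegralLevel L 3 H' v : Set ((cmDatum L 3 H').Local v)).indicator fun _ => (1 : ℂ)) c :=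
  (stableOrbitalIntegralRel_eq_finsum_finExplicitDelta_iff_of_isLocalStablyConjH L H' μ hl hr mH mG _ _ h).1
    (stableOrbitalIntegralRel_indicator_eq_finsum_finExplicitDelta_of_separable_redMat_of_nonsplit L H' hH' w hw hv hH'w hH'i μ hμ
      νH νG hmH hmG hνH hνG hl hr hγH hreg hsepι hsep₂ hc)

end Transport

end Literature.NumberTheory.Rogawski1990
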